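import Summits.KontsevichZagierPeriods.KontsevichZagierPeriods.Theses.FurushoPentagon
import Summits.KontsevichZagierPeriods.KontsevichZagierPeriods.Theorems.StuffleInKZ.Negative.LoadBearing
import Summits.KontsevichZagierPeriods.KontsevichZagierPeriods.Theorems.StuffleInKZ.Negative.ChangeOfVariablesNecessary
import Summits.KontsevichZagierPeriods.KontsevichZagierPeriods.Theorems.StuffleInKZ.Negative.IntegrandAdditivityDerived
import Summits.KontsevichZagierPeriods.KontsevichZagierPeriods.Theorems.HoffmanRelationInKZ.Negative.NoStokesLocality
import Literature.NumberTheory.Transcendental.KZKernelConjectureForms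
import Literature.Barriers.KontsevichZagierPeriods.GrothendieckPeriodConjectureDependenceOddZetaProofs
import Summits.KontsevichZagierPeriods.KontsevichZagierPeriods.Theses.LinRedNormalForm

/-!
# Disproof of `SectorToKernel` (crux stmt-KontsevichZagierPeriods-10813) — findings

Standing adversary file of the crux disprover (route FurushoPentagon; rank-9 support item promoted to
crux by the gate on 2026-08-16 because its docstring avows "open problem"). Everything below is
`sorry`-free; prose only in docstrings.

The crux is

  `SectorToKernel : StuffleInKZ → HoffmanRelationInKZ → ∀ c, KZ.eval c = 0 → c ∈ KZ.relations`.

**VERDICT (cycle 1): NO KILL, and no kill exists short of a disproof of the summit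
`KontsevichZagierPeriods` TOGETHER WITH proofs of the two open cruxes `StuffleInKZ` (stmt-3931) and
`HoffmanRelationInKZ` (stmt-3930)** — `not_iff_summit` below is the exact statement.

## Index

* §0 unfolding: the conclusion `KernelForm` is verbatim `KZKernelConjecture` (`Iff.rfl`) and is the summit
  (`kernelForm_iff_summit`, from the tree's `kzKernelConjecture_iff_isRational`, p14942).
* §1 the conclusion alone proves the crux (`of_kernelForm`, `of_summit`).
* §2 the HYPOTHESES ARE CONSEQUENCES OF THE CONCLUSION (`hyps_of_kernelForm`; siblings' landed Negative lemmas
  `StuffleInKZ.Negative.stuffleInKZ_of_kernel`, `HoffmanRelationInKZ.Negative.of_kernelForm`: Hoffman 1992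
  Thm 5.1, Hoffman 1997 Thm 4.2 and Kontsevich's formula are tree theorems, so both defects evaluate to `0`).
* §3 ANATOMY: `iff_or` (`SectorToKernel ↔ K ∨ ¬S ∨ ¬H`), `not_iff` / `not_iff_summit`
  (`¬SectorToKernel ↔ S ∧ H ∧ ¬summit`), `not_summit_of_not` (a kill kills Conjecture 1),
  `iff_summit_of_hyps` (once the route's mechanism has delivered S and H, the item IS the summit),
  `summit_of_proof` (a proof of the crux + proofs of S, H = a proof of Conjecture 1); the two vacuity escapes
  `of_not_stuffleInKZ`, `of_not_hoffmanRelationInKZ` are themselves disproofs of the summit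
  (`not_summit_of_not_stuffleInKZ`, `not_summit_of_not_hoffmanRelationInKZ`).
* §4 LOAD-BEARING ANALYSIS: dropping either hypothesis or both gives `KernelForm ∨ ¬(other)` resp. the summit
  itself (`withoutStuffle_iff`, `withoutHoffman_iff`, `withoutHyps_iff_summit`); NO `_false_without_` theorem is
  available for any of them unless Conjecture 1 is false (`not_withoutHyps_iff`, `not_summit_of_not_without*`):
  the hypotheses carry no weight — they are outputs of the conclusion, not inputs to it.
* §5 SHAPE OF A COUNTEREXAMPLE: an element of `ker eval ∖ relations` (`counterexample_shape`), equivalently two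
  KZ-literal rational representations of one number not joined by moves (`counterexample_shape_reps`); the only
  invariant of `relations` in the tree is `eval` itself (`not_mem_relations_of_eval_ne_zero` is all soundness
  gives), so no EVALUATIVE refutation can exist — a kill needs a NEW additive invariant of all four move families
  vanishing on `relations` but not on `ker eval`, i.e. a disproof of the period conjecture for this calculus.
* §6 NATURAL STRENGTHENINGS REFUTED — the kernel form is FALSE for every sub-calculus omitting a rule type:
  `kernelForm_false_noStokes` (rules 1a+1b+2: dimension grading, witness `[slab over pt] − [pt,1]`),
  `kernelForm_false_covNL` (rules 2+3: augmentation, witness `[pt,1] + [pt,−1]`),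
  `kernelForm_false_covFree` (rules 1a+1b+3: the (2,2)-stuffle defect has no algebraic shadow — sibling
  `StuffleInKZ.Negative.Necessary`). So any proof of the conclusion uses additivity AND a change of variables AND
  Newton–Leibniz; and the corresponding weakenings of the crux ("… → c ∈ sub-closure") are false as soon as
  S and H hold. Dropping (1b) alone changes nothing (`kernelForm_iff_threeRules`, sibling's derived-rule theorem).
* §7 BARRIER POSITIONING (`Literature.Barriers.KontsevichZagierPeriods.kzConjecture_implies_oddZetaAlgIndep`,
  the sector's catalogued barrier): granted that (named, unproved) implication, a proof of the crux plus proofs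
  of S and H proves `ZetaFiveIrrational` and `OddZetaIrrational` (`zetaFiveIrrational_of`,
  `oddZetaIrrational_of`) — the item is transcendence-hard even relative to its hypotheses; it does not evade
  the barrier, it IS the barrier's antecedent.
* §8 a kernel-checked certificate for the weight-4 remark of the planner briefing below (`weightFour_gloss_certificate`).
* §9 CROSS-ROUTE: the typed form of the gloss "inside the MZV span" is route LinRedNormalForm's crux `MzvKernelInKZ`
  (stmt-KontsevichZagierPeriods-3914: the kernel form on ℤ-combinations of rational multiples of convergent word-simplex
  representations); `K ⇒ MzvKernelInKZ` (`mzvKernelInKZ_of_kernelForm`), so crux + S + H ⇒ 3914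
  (`mzvKernelInKZ_of_sectorToKernel`) and a kill of 3914 kills the summit (`not_summit_of_not_mzvKernelInKZ`) and, given
  S and H, this crux (`not_sectorToKernel_of_not_mzvKernelInKZ`).

## Junk hunt in the formal calculus (no finding; recorded so nobody repeats it)
`KZ.IntegralRep` = ℚ-semialgebraic domain + ℚ-semialgebraic integrand (graph) + `IntegrableOn`; `eval` = Bochner
set integral; soundness `relations ≤ ker eval` is a tree theorem. Empty / null domains: killed by (1a) with
`σ = σ ∪ σ` (`KZ.IntegralRep.of_empty_mem_relations`); integrands differing off the domain: killed by (1b);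
dimension `0`: real algebraic constants, unit `[pt,1]` of value `1`; dimension shifts: slabs (`equivalent_slab`);
Newton–Leibniz carries `a ≤ b` (the unsound variant is excluded). No element of `ker eval` with a provable
non-membership certificate was found; none is expected without a new invariant (§5).

## Prover / planner briefing
Do not staff. `closes` consumes the item only as `K`; after StuffleInKZ and HoffmanRelationInKZ land the residual
claim of route FurushoPentagon is `iff_summit_of_hyps`: Conjecture 1 itself. A refuter can only ever return here
with a disproof of the summit in hand (route Neg), at which point `not_iff_summit` converts it.

Remark on the informal gloss ("inside the MZV span this is IKZ Conjecture 1 in form (3): FDS + Hoffman generate all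
relations"): the TYPED hypotheses are the stuffle half of FDS plus Hoffman only — the shuffle half is the separate
support item `ShuffleIsDissection`, not an antecedent here. Algebraically the typed pair does not even span weight 4:
the admissible indices are (4), (3,1), (2,2), (2,1,1), `d₄ = 1`, so three relations are needed; Hoffman gives two
(`s = (3)`: ζ(4) = ζ(3,1) + ζ(2,2); `s = (2,1)`: ζ(3,1) + ζ(2,2) = ζ(2,1,1)), duality adds nothing new
((3,1), (2,2) self-dual; (4)† = (2,1,1) is the difference of the two), and the stuffle `[Δ₂]² = 2[Δ_{2,2}] + [Δ₄]`
only ties the product generator to them; the third relation ζ(4) = 4ζ(3,1) (`Zeta4Calibration`, Grothendieck 0275)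
needs the shuffle `[Δ₂]² = 2[Δ_{2,2}] + 4[Δ_{3,1}]` or the pentagon. This concerns the gloss only: the typed crux is a
material implication whose conclusion is the whole of Conjecture 1, so its truth value does not depend on what the
antecedents generate.
-/

noncomputable section

set_option linter.dupNamespace false

namespace Summit.KontsevichZagierPeriods.KontsevichZagierPeriods.Cruxes.SectorToKernel.Disproof

open MeasureTheory Set
open Literature.NumberTheory.Transcendental
open Literature.NumberTheory.Transcendental.KZ
open Summit.KontsevichZagierPeriods.KontsevichZagierPeriods.Theses.FurushoPentagon

open Summit.KontsevichZagierPeriods.Theorems.StuffleInKZ.Negative (stuffleInKZ_of_kernel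
  not_summit_of_not_stuffleInKZ of_unit_not_mem_relations covNLRelations covNLRelations_le_ker_aug aug aug_of
  covFreeRelations defect Zcan Zcan_of_isAdmissible eval_defect)
open Summit.KontsevichZagierPeriods.HoffmanRelationInKZ.Negative (noStokes noStokesDim dimProj
  dimProj_of_self dimProj_of_ne dimProj_mem_noStokesDim noStokesDim_le_noStokes noStokes_le_relations)

/-! ## §0 Unfolding -/

/-- The kernel form of Conjecture 1 — the crux's conclusion, written out. -/
abbrev KernelForm : Prop := ∀ c : FormalRep, eval c = 0 → c ∈ relations

/-- The conclusion is VERBATIM the tree's conjecture leaf `KZKernelConjecture`. [folklore] -/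
theorem kernelForm_iff_kzKernelConjecture : KernelForm ↔ KZKernelConjecture := Iff.rfl

/-- Unfolding of the crux. [folklore] -/
theorem sectorToKernel_iff :
    SectorToKernel ↔ (StuffleInKZ → HoffmanRelationInKZ → KernelForm) := Iff.rfl

/-- **The conclusion is the summit** (tree theorem `kzKernelConjecture_iff_isRational`, p14942, composed with
the definitional unfolding `KontsevichZagierPeriods_iff`). [folklore] -/
theorem kernelForm_iff_summit : KernelForm ↔ KontsevichZagierPeriods :=
  kzKernelConjecture_iff_isRational.trans KontsevichZagierPeriods_iff.symm

/-! ## §1 The conclusion alone proves the crux -/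

/-- `K ⇒ crux` (the hypotheses are not used). [folklore] -/
theorem of_kernelForm (h : KernelForm) : SectorToKernel := fun _ _ => h

/-- `summit ⇒ crux`. [folklore] -/
theorem of_summit (h : KontsevichZagierPeriods) : SectorToKernel :=
  of_kernelForm (kernelForm_iff_summit.mpr h)

/-! ## §2 The hypotheses are consequences of the conclusion -/

/-- **`K ⇒ StuffleInKZ ∧ HoffmanRelationInKZ`**: both hypotheses of the crux follow from its conclusion
(the stuffle defect and Hoffman's element evaluate to `0` — Hoffman 1997 Thm 4.2 `multipleZeta_mul`,
Hoffman 1992 Thm 5.1 `multipleZeta_hoffman_relation`, Kontsevich's formula `KZ.mzvRep_value_holds` — and `K`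
puts `ker eval` into `relations`). [folklore] -/
theorem hyps_of_kernelForm (h : KernelForm) : StuffleInKZ ∧ HoffmanRelationInKZ :=
  ⟨stuffleInKZ_of_kernel h, Summit.KontsevichZagierPeriods.HoffmanRelationInKZ.Negative.of_kernelForm h⟩

/-- `summit ⇒ StuffleInKZ ∧ HoffmanRelationInKZ`. [folklore] -/
theorem hyps_of_summit (h : KontsevichZagierPeriods) : StuffleInKZ ∧ HoffmanRelationInKZ :=
  hyps_of_kernelForm (kernelForm_iff_summit.mpr h)

/-! ## §3 Anatomy: what a proof and what a refutation of the crux are -/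

/-- **`SectorToKernel ↔ K ∨ ¬S ∨ ¬H`.** [folklore] -/
theorem iff_or : SectorToKernel ↔ (KernelForm ∨ ¬ StuffleInKZ ∨ ¬ HoffmanRelationInKZ) := by
  constructor
  · intro h
    by_cases hS : StuffleInKZ
    · by_cases hH : HoffmanRelationInKZ
      · exact Or.inl (h hS hH)
      · exact Or.inr (Or.inr hH)
    · exact Or.inr (Or.inl hS)
  · rintro (hK | hS | hH)
    · exact of_kernelForm hK
    · exact fun hS' _ => absurd hS' hS
    · exact fun _ hH' => absurd hH' hH

/-- **`¬SectorToKernel ↔ S ∧ H ∧ ¬K`**: a refutation is a proof of both open cruxes AND a disproof of the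
kernel form. [folklore] -/
theorem not_iff : ¬ SectorToKernel ↔ (StuffleInKZ ∧ HoffmanRelationInKZ ∧ ¬ KernelForm) := by
  constructor
  · intro h
    by_cases hS : StuffleInKZ
    · by_cases hH : HoffmanRelationInKZ
      · exact ⟨hS, hH, fun hK => h (of_kernelForm hK)⟩
      · exact absurd (fun _ hH' => absurd hH' hH) h
    · exact absurd (fun hS' _ => absurd hS' hS) h
  · rintro ⟨hS, hH, hK⟩ h
    exact hK (h hS hH)

/-- **`¬SectorToKernel ↔ S ∧ H ∧ ¬KontsevichZagierPeriods`.** [folklore] -/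
theorem not_iff_summit :
    ¬ SectorToKernel ↔ (StuffleInKZ ∧ HoffmanRelationInKZ ∧ ¬ KontsevichZagierPeriods) := by
  rw [not_iff, kernelForm_iff_summit]

/-- **A kill of this crux is a kill of the summit.** [folklore] -/
theorem not_summit_of_not (h : ¬ SectorToKernel) : ¬ KontsevichZagierPeriods :=
  (not_iff_summit.mp h).2.2

/-- Given the two hypotheses (the route's mechanism output), the crux IS the kernel form. [folklore] -/
theorem iff_kernelForm_of_hyps (hS : StuffleInKZ) (hH : HoffmanRelationInKZ) :
    SectorToKernel ↔ KernelForm :=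
  ⟨fun h => h hS hH, of_kernelForm⟩

/-- **Given the two hypotheses, the crux IS Conjecture 1** — the residual claim of route FurushoPentagon
after its mechanism succeeds. [folklore] -/
theorem iff_summit_of_hyps (hS : StuffleInKZ) (hH : HoffmanRelationInKZ) :
    SectorToKernel ↔ KontsevichZagierPeriods :=
  (iff_kernelForm_of_hyps hS hH).trans kernelForm_iff_summit

/-- A proof of the crux together with proofs of its hypotheses is a proof of Conjecture 1. [folklore] -/
theorem summit_of_proof (h : SectorToKernel) (hS : StuffleInKZ) (hH : HoffmanRelationInKZ) :
    KontsevichZagierPeriods :=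
  kernelForm_iff_summit.mp (h hS hH)

/-- Vacuity escape 1: `¬StuffleInKZ ⇒ crux` … [folklore] -/
theorem of_not_stuffleInKZ (h : ¬ StuffleInKZ) : SectorToKernel := fun hS _ => absurd hS h

/-- … which is itself a disproof of the summit (sibling `not_summit_of_not_stuffleInKZ`). [folklore] -/
theorem not_summit_of_not_stuffleInKZ (h : ¬ StuffleInKZ) : ¬ KontsevichZagierPeriods :=
  Summit.KontsevichZagierPeriods.Theorems.StuffleInKZ.Negative.not_summit_of_not_stuffleInKZ h

/-- Vacuity escape 2: `¬HoffmanRelationInKZ ⇒ crux` … [folklore] -/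
theorem of_not_hoffmanRelationInKZ (h : ¬ HoffmanRelationInKZ) : SectorToKernel :=
  fun _ hH => absurd hH h

/-- … which is itself a disproof of the summit (sibling `HoffmanRelationInKZ.Negative.not_summit_of_not`).
[folklore] -/
theorem not_summit_of_not_hoffmanRelationInKZ (h : ¬ HoffmanRelationInKZ) : ¬ KontsevichZagierPeriods :=
  Summit.KontsevichZagierPeriods.HoffmanRelationInKZ.Negative.not_summit_of_not h

/-- **Trichotomy of any proof**: a proof of the crux either proves Conjecture 1 or refutes it (through one of
its two MZV consequences). [folklore] -/
theorem summit_or_not_summit_of_proof (h : SectorToKernel) :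
    KontsevichZagierPeriods ∨ (¬ KontsevichZagierPeriods ∧ (¬ StuffleInKZ ∨ ¬ HoffmanRelationInKZ)) := by
  rcases iff_or.mp h with hK | hS | hH
  · exact Or.inl (kernelForm_iff_summit.mp hK)
  · exact Or.inr ⟨not_summit_of_not_stuffleInKZ hS, Or.inl hS⟩
  · exact Or.inr ⟨not_summit_of_not_hoffmanRelationInKZ hH, Or.inr hH⟩

/-- **Complete case analysis.** Either Conjecture 1 holds and the crux with it (hypotheses idle), or
Conjecture 1 fails and the crux is exactly the statement that one of its two hypotheses fails. [folklore] -/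
theorem cases_complete :
    (KontsevichZagierPeriods ∧ SectorToKernel) ∨
    (¬ KontsevichZagierPeriods ∧ (SectorToKernel ↔ ¬ (StuffleInKZ ∧ HoffmanRelationInKZ))) := by
  by_cases hs : KontsevichZagierPeriods
  · exact Or.inl ⟨hs, of_summit hs⟩
  · refine Or.inr ⟨hs, ?_⟩
    rw [iff_or, kernelForm_iff_summit, not_and_or]
    constructor
    · rintro (h | h | h)
      · exact absurd h hs
      · exact Or.inl h
      · exact Or.inr h
    · rintro (h | h)
      · exact Or.inr (Or.inl h)
      · exact Or.inr (Or.inr h)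

/-- In particular the crux is equivalent to its own conclusion in every world where Conjecture 1 holds, and
nothing weaker than `¬(S ∧ H)` in every world where it fails. [folklore] -/
theorem iff_kernelForm_or_not_summit : (SectorToKernel ↔ KernelForm) ∨ ¬ KontsevichZagierPeriods := by
  by_cases hs : KontsevichZagierPeriods
  · exact Or.inl ⟨fun _ => kernelForm_iff_summit.mpr hs, of_kernelForm⟩
  · exact Or.inr hs

/-! ## §4 Load-bearing analysis: the hypotheses carry no weight -/

/-- The crux with `StuffleInKZ` dropped. -/
def SectorToKernelWithoutStuffle : Prop := HoffmanRelationInKZ → KernelForm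

/-- The crux with `HoffmanRelationInKZ` dropped. -/
def SectorToKernelWithoutHoffman : Prop := StuffleInKZ → KernelForm

/-- The crux with both hypotheses dropped: the bare kernel form. -/
def SectorToKernelWithoutHyps : Prop := KernelForm

/-- Strength chain `WithoutHyps ⇒ WithoutStuffle ⇒ crux` and `WithoutHyps ⇒ WithoutHoffman ⇒ crux`. [folklore] -/
theorem chain :
    (SectorToKernelWithoutHyps → SectorToKernelWithoutStuffle) ∧
    (SectorToKernelWithoutHyps → SectorToKernelWithoutHoffman) ∧
    (SectorToKernelWithoutStuffle → SectorToKernel) ∧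
    (SectorToKernelWithoutHoffman → SectorToKernel) :=
  ⟨fun h _ => h, fun h _ => h, fun h _ hH => h hH, fun h hS _ => h hS⟩

/-- Dropping both hypotheses gives exactly Conjecture 1. [folklore] -/
theorem withoutHyps_iff_summit : SectorToKernelWithoutHyps ↔ KontsevichZagierPeriods :=
  kernelForm_iff_summit

/-- Dropping the stuffle: `(H → K) ↔ (K ∨ ¬H)`. [folklore] -/
theorem withoutStuffle_iff : SectorToKernelWithoutStuffle ↔ (KernelForm ∨ ¬ HoffmanRelationInKZ) := by
  unfold SectorToKernelWithoutStuffle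
  constructor
  · intro h
    by_cases hH : HoffmanRelationInKZ
    · exact Or.inl (h hH)
    · exact Or.inr hH
  · rintro (hK | hH) hH'
    · exact hK
    · exact absurd hH' hH

/-- Dropping Hoffman: `(S → K) ↔ (K ∨ ¬S)`. [folklore] -/
theorem withoutHoffman_iff : SectorToKernelWithoutHoffman ↔ (KernelForm ∨ ¬ StuffleInKZ) := by
  unfold SectorToKernelWithoutHoffman
  constructor
  · intro h
    by_cases hS : StuffleInKZ
    · exact Or.inl (h hS)
    · exact Or.inr hS
  · rintro (hK | hS) hS'
    · exact hK
    · exact absurd hS' hS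

/-- **No `_false_without_Hyps` theorem unless Conjecture 1 is false.** [folklore] -/
theorem not_withoutHyps_iff : ¬ SectorToKernelWithoutHyps ↔ ¬ KontsevichZagierPeriods :=
  not_congr withoutHyps_iff_summit

/-- **No `_false_without_Stuffle` theorem unless Conjecture 1 is false.** [folklore] -/
theorem not_summit_of_not_withoutStuffle (h : ¬ SectorToKernelWithoutStuffle) : ¬ KontsevichZagierPeriods :=
  fun hs => h fun _ => kernelForm_iff_summit.mpr hs

/-- **No `_false_without_Hoffman` theorem unless Conjecture 1 is false.** [folklore] -/
theorem not_summit_of_not_withoutHoffman (h : ¬ SectorToKernelWithoutHoffman) : ¬ KontsevichZagierPeriods :=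
  fun hs => h fun _ => kernelForm_iff_summit.mpr hs

/-- Precisely: `¬WithoutStuffle ↔ H ∧ ¬summit` … [folklore] -/
theorem not_withoutStuffle_iff :
    ¬ SectorToKernelWithoutStuffle ↔ (HoffmanRelationInKZ ∧ ¬ KontsevichZagierPeriods) := by
  rw [withoutStuffle_iff, not_or, not_not, kernelForm_iff_summit, and_comm]

/-- … and `¬WithoutHoffman ↔ S ∧ ¬summit`. [folklore] -/
theorem not_withoutHoffman_iff :
    ¬ SectorToKernelWithoutHoffman ↔ (StuffleInKZ ∧ ¬ KontsevichZagierPeriods) := by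
  rw [withoutHoffman_iff, not_or, not_not, kernelForm_iff_summit, and_comm]

/-! ## §5 Shape of a counterexample; no evaluative refutation -/

/-- A refutation exhibits an element of `ker eval ∖ relations`. [folklore] -/
theorem counterexample_shape (h : ¬ SectorToKernel) : ∃ c : FormalRep, eval c = 0 ∧ c ∉ relations := by
  obtain ⟨-, -, hK⟩ := not_iff.mp h
  by_contra hc
  push Not at hc
  exact hK hc

/-- Equivalently (two-representation form): two KZ-literal rational representations of one real number that
no finite chain of moves joins. [folklore] -/
theorem counterexample_shape_reps (h : ¬ SectorToKernel) :
    ∃ (n m : ℕ) (r : IntegralRep n) (r' : IntegralRep m),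
      r.IsRational ∧ r'.IsRational ∧ r.value = r'.value ∧ ¬ Equivalent r r' := by
  have hs : ¬ KontsevichZagierPeriods := not_summit_of_not h
  rw [KontsevichZagierPeriods_iff] at hs
  push Not at hs
  obtain ⟨n, m, r, r', hr, hr', hv, hne⟩ := hs
  exact ⟨n, m, r, r', hr, hr', hv, hne⟩

/-- All that soundness gives: a combination of NON-zero value is not a relation. Candidates for a kill lie in
`ker eval`, where `eval` — the only invariant of `relations` in the tree — is silent. [folklore] -/
theorem not_mem_relations_of_eval_ne_zero {c : FormalRep} (hc : eval c ≠ 0) : c ∉ relations :=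
  fun h => hc (relations_le_ker_eval_holds h)

/-- Conversely the conclusion restricted to combinations of non-zero value is vacuous, and on `ker eval` it is
the whole conjecture: there is no intermediate evaluative test. [folklore] -/
theorem kernelForm_iff_ker_le : KernelForm ↔ eval.ker ≤ relations :=
  ⟨fun h c hc => h c hc, fun h _ hc => h hc⟩

/-! ## §6 Natural strengthenings refuted: the kernel form fails for every proper sub-calculus -/

/-- **Newton–Leibniz is necessary**: the kernel form is FALSE for the Stokes-free sub-calculus
`closure (domainAddRel ∪ integrandAddRel ∪ changeOfVariablesRel)`. Witness `[slab over pt] − [pt, 1]`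
(value `1 − 1 = 0`): the Stokes-free moves are dimension-graded (sibling `dimProj_mem_noStokesDim`), and the
dimension-`0` component `−[pt,1]` has value `−1`. (The sibling lane of `StuffleInKZ` has the same failure for its
identically defined `nlFreeRelations`: `StuffleInKZ.Negative.not_kernel_le_nlFree`, witness `∫₀¹dt − [pt,1]`.) [folklore] -/
theorem kernelForm_false_noStokes : ¬ ∀ c : FormalRep, eval c = 0 → c ∈ noStokes := by
  intro h
  set c : FormalRep := of (IntegralRep.unit.slab 0) - of IntegralRep.unit with hc
  have hrel : c ∈ relations := by
    have h1 : of IntegralRep.unit - of (IntegralRep.unit.slab 0) ∈ relations :=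
      IntegralRep.equivalent_slab IntegralRep.unit 0
    have h2 := relations.neg_mem h1
    rwa [neg_sub] at h2
  have h0 : eval c = 0 := relations_le_ker_eval_holds hrel
  have hns : c ∈ noStokes := h c h0
  have hproj : dimProj 0 c = -of IntegralRep.unit := by
    rw [hc, map_sub, dimProj_of_ne _ (Nat.succ_ne_zero 0), dimProj_of_self, zero_sub]
  have hmem : dimProj 0 c ∈ relations :=
    noStokes_le_relations (noStokesDim_le_noStokes 0 (dimProj_mem_noStokesDim 0 hns))
  rw [hproj] at hmem
  exact of_unit_not_mem_relations (by simpa using relations.neg_mem hmem)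

/-- **Additivity is necessary**: the kernel form is FALSE for the sub-calculus of rules (2) + (3)
`closure (changeOfVariablesRel ∪ newtonLeibnizRel)`. Witness `[pt, 1] + [pt, −1]` (value `0`, augmentation `2`;
sibling `covNLRelations_le_ker_aug`). [folklore] -/
theorem kernelForm_false_covNL : ¬ ∀ c : FormalRep, eval c = 0 → c ∈ covNLRelations := by
  intro h
  set c : FormalRep := of IntegralRep.unit + of IntegralRep.unit.neg with hc
  have h0 : eval c = 0 := by
    rw [hc, map_add, eval_of, eval_of, IntegralRep.value_neg, IntegralRep.value_unit, add_neg_cancel]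
  have hmem := covNLRelations_le_ker_aug (h c h0)
  rw [AddMonoidHom.mem_ker, hc, map_add, aug_of, aug_of] at hmem
  norm_num at hmem

/-- **A change of variables is necessary**: the kernel form is FALSE for the CoV-free sub-calculus
`closure (domainAddRel ∪ integrandAddRel ∪ newtonLeibnizRel)`. Witness: the (2,2) stuffle defect
`[Δ₂]² − 2[Δ_{2,2}] − [Δ₄]`, of value `0` (Hoffman 1997 Thm 4.2), which has no algebraic shadow (sibling
`StuffleInKZ.Negative.Necessary.defect_two_two_not_mem_covFreeRelations`; the sibling's own kernel-form
failure, by a swap witness, is `StuffleInKZ.Negative.not_kernel_le_covFree`). [folklore] -/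
theorem kernelForm_false_covFree : ¬ ∀ c : FormalRep, eval c = 0 → c ∈ covFreeRelations := by
  intro h
  have h0 : eval (defect Zcan [2] [2]) = 0 :=
    eval_defect Zcan_of_isAdmissible (by decide) (by decide)
  exact Summit.KontsevichZagierPeriods.Theorems.StuffleInKZ.Negative.Necessary.defect_two_two_not_mem_covFreeRelations
    (h _ h0)

/-- Omitting (1b) ALONE changes nothing: `relations = closure (1a ∪ 2 ∪ 3)` (sibling
`StuffleInKZ.Negative.Derived.relations_eq_closure_three_rules`: integrand additivity is a derived rule), so the
kernel form for that sub-calculus IS the kernel form; with §6's three failures this is the complete profile for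
sub-calculi obtained by dropping one of KZ's rules 1), 2), 3) (and (1b)); dropping (1a) alone is open (sibling, loc. cit.).
[folklore] -/
theorem kernelForm_iff_threeRules :
    KernelForm ↔ ∀ c : FormalRep, eval c = 0 →
      c ∈ AddSubgroup.closure (domainAddRel ∪ changeOfVariablesRel ∪ newtonLeibnizRel) := by
  rw [← Summit.KontsevichZagierPeriods.Theorems.StuffleInKZ.Negative.Derived.relations_eq_closure_three_rules]

/-- Hence the three weakened cruxes "S → H → (ker eval ⊆ sub-closure)" are refuted AS SOON AS S and H hold
(and are, like the crux, irrefutable before): recorded for the Stokes-free one. [folklore] -/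
theorem not_sectorToNoStokes_of_hyps (hS : StuffleInKZ) (hH : HoffmanRelationInKZ) :
    ¬ (StuffleInKZ → HoffmanRelationInKZ → ∀ c : FormalRep, eval c = 0 → c ∈ noStokes) :=
  fun h => kernelForm_false_noStokes (h hS hH)

/-! ## §7 Barrier positioning: transcendence-hardness relative to the hypotheses -/

/-- Granted the catalogued barrier fact `kzConjecture_implies_oddZetaAlgIndep` (Huber–Wüstholz 2022,
Prologue p. xvi: "The Period Conjecture implies that the ζ(2n+1) are algebraically independent"), a proof of the
crux plus proofs of its two hypotheses proves `ζ(5) ∉ ℚ` (open). [folklore] -/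
theorem zetaFiveIrrational_of
    (hB : Literature.Barriers.KontsevichZagierPeriods.kzConjecture_implies_oddZetaAlgIndep)
    (h : SectorToKernel) (hS : StuffleInKZ) (hH : HoffmanRelationInKZ) : ZetaFiveIrrational :=
  Literature.Barriers.KontsevichZagierPeriods.zetaFiveIrrational_of_kzKernel hB (h hS hH)

/-- Same, for the irrationality of every `ζ(2k+1)`, `k ≥ 1` (open). [folklore] -/
theorem oddZetaIrrational_of
    (hB : Literature.Barriers.KontsevichZagierPeriods.kzConjecture_implies_oddZetaAlgIndep)
    (h : SectorToKernel) (hS : StuffleInKZ) (hH : HoffmanRelationInKZ) : OddZetaIrrational :=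
  Literature.Barriers.KontsevichZagierPeriods.oddZetaIrrational_of_kzKernel hB (h hS hH)

/-! ## §8 The informal gloss at weight 4 (a certificate for the docblock remark)

Coordinates `(ζ(4), ζ(3,1), ζ(2,2), ζ(2,1,1))`. Hoffman `s = (3)`: `h₁ = (1,−1,−1,0)`; Hoffman `s = (2,1)`:
`h₂ = (0,1,1,−1)`; duality `(4)† = (2,1,1)`: `δ = (1,0,0,−1) = h₁ + h₂`; the calibration ζ(4) = 4ζ(3,1):
`v = (1,−4,0,0)`. The functional `ℓ = (1,1,0,1)` kills `h₁, h₂` (hence `δ`) but `ℓ(v) = −3`: so `v` is not a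
ℚ-combination of the weight-4 Hoffman and duality vectors — the third weight-4 relation needs the shuffle half of FDS
(IharaKanekoZagier2006 p. 315, family (3) = FDS + Hoffman), which the typed antecedents of the crux do not carry. -/

/-- The weight-4 certificate: `ℓ ⟂ h₁, h₂`, `δ = h₁ + h₂`, `ℓ(v) ≠ 0` (dot products over `ℤ`). [folklore] -/
theorem weightFour_gloss_certificate :
    let h₁ : Fin 4 → ℤ := ![1, -1, -1, 0]
    let h₂ : Fin 4 → ℤ := ![0, 1, 1, -1]
    let δ : Fin 4 → ℤ := ![1, 0, 0, -1]
    let v : Fin 4 → ℤ := ![1, -4, 0, 0]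
    let ℓ : Fin 4 → ℤ := ![1, 1, 0, 1]
    (∑ i, ℓ i * h₁ i = 0) ∧ (∑ i, ℓ i * h₂ i = 0) ∧ (δ = h₁ + h₂) ∧ (∑ i, ℓ i * v i = -3) := by
  refine ⟨by decide, by decide, by decide, by decide⟩

/-! ## §9 Cross-route: the MZV-span part of the conclusion is LinRedNormalForm's crux `MzvKernelInKZ` -/

/-- `K ⇒ MzvKernelInKZ` (stmt-KontsevichZagierPeriods-3914): the kernel form restricted to the subgroup generated by
rational multiples of convergent word-simplex representations. [folklore] -/
theorem mzvKernelInKZ_of_kernelForm (h : KernelForm) :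
    Summit.KontsevichZagierPeriods.KontsevichZagierPeriods.Theses.LinRedNormalForm.MzvKernelInKZ :=
  fun c _ hc => h c hc

/-- crux + S + H ⇒ `MzvKernelInKZ`. [folklore] -/
theorem mzvKernelInKZ_of_sectorToKernel (h : SectorToKernel) (hS : StuffleInKZ) (hH : HoffmanRelationInKZ) :
    Summit.KontsevichZagierPeriods.KontsevichZagierPeriods.Theses.LinRedNormalForm.MzvKernelInKZ :=
  mzvKernelInKZ_of_kernelForm (h hS hH)

/-- A kill of `MzvKernelInKZ` kills the summit (also that crux's own lane:
`MzvKernelInKZ.Negative.not_summit_of_not`) … [folklore] -/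
theorem not_summit_of_not_mzvKernelInKZ
    (h : ¬ Summit.KontsevichZagierPeriods.KontsevichZagierPeriods.Theses.LinRedNormalForm.MzvKernelInKZ) :
    ¬ KontsevichZagierPeriods :=
  fun hs => h (mzvKernelInKZ_of_kernelForm (kernelForm_iff_summit.mpr hs))

/-- … and, given S and H, this crux. [folklore] -/
theorem not_sectorToKernel_of_not_mzvKernelInKZ
    (h : ¬ Summit.KontsevichZagierPeriods.KontsevichZagierPeriods.Theses.LinRedNormalForm.MzvKernelInKZ)
    (hS : StuffleInKZ) (hH : HoffmanRelationInKZ) : ¬ SectorToKernel :=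
  fun hK => h (mzvKernelInKZ_of_sectorToKernel hK hS hH)

end Summit.KontsevichZagierPeriods.KontsevichZagierPeriods.Cruxes.SectorToKernel.Disproof
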